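/-
Copyright: statement-level skeleton of a published paper (lit-balaban cell, Phase-2 proof seat p10, gen 2). No proof claims
beyond what the kernel checks below.
-/
import Mathlib
import Literature.MathematicalPhysics.QuantumFieldTheory.BalabanImbrieJaffe1984to88.BIJ85MomentumSymbols71
import Literature.MathematicalPhysics.QuantumFieldTheory.Balaban1983to89.B5Prop11Fiber

/-!
# `BalabanImbrieJaffe1984to88.BIJ85MomentumSymbols6I` — T. Bałaban, J. Imbrie, A. Jaffe, *Renormalization of the Higgs model:
minimizers, propagators and the stability of mean field theory*, Commun. Math. Phys. **97** (1985) 299–329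
[BalabanImbrieJaffe1985]: Sect. 7.1 p. 322 — the dictionary between the momentum symbols (7.1.4), (7.1.7), (7.1.9) and the
functions ∂_μ(p′+l), v_μ, u of [6I] = [Balaban1984PropagatorsI] (1.31)/(1.61), PROVED

statement-level skeleton of published theorems with citation tags; proofs where landed; nothing here is a claim about
the Yang–Mills mass gap

PDF held: `paper:balaban1985-cmp97-bij-higgs-minimizers` (journal page = PDF page + 298).  Render read as an image: PDF p. 24
(journal 322), poppler render in the seat folder (`renders/c2-p024.png`).

CITATION HEADER (lean-in-tree rule).  Part of the lit-balaban TYPED SKELETON (HOME `run/shared/lean/pub/lit-balaban/`); WHAT IS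
REPRODUCED: the cross-paper edge of SKELETON row **C1.Eq7.1.2-7.1.12** (`HOME/lit-balaban-r15/ROWS-C1.md`, fold owner r15; row
of record = r15's `BIJ85MomentumSymbols71`) to **B5.Eq1.83-1.84** — p. 322: *"The operator G_k was given in the momentum
representation in [6I, Eqs. (1.83) and (1.84)]. Starting from this expression, one can derive the following formulas for σ_k(p)
by straightforward, algebraic manipulation"*.  PROVED: at η = 1/n and p = p′ + l, l = 2πk (the tree's `B4Strip.shiftr n k p′`,
k ∈ (Fin n)^d), the C1 symbols ∂_μ(p) (7.1.4), v_μ(p) (7.1.7) and u(p) (7.1.9) of `BIJ85MomentumSymbols71` ARE the functions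
`dSym`, `vSym`, `uSym` of `Balaban1983to89.B5Prop11Fiber` ([6I] (1.31), (1.61), over which [6I]'s (1.83)–(1.84) fibre matrices
`B5Prop11Fiber.balabanFiber`/Proposition 1.1 are typed and proved): `dSym_eq_6I` (unconditionally), `vSym_eq_6I` and `uSym_eq_6I`
(where no ∂_μ(p) vanishes — CONVENTION NOTE: `BIJ85MomentumSymbols71.vSym` is the raw quotient ∂^{(1)}_μ(p′)/∂_μ(p), = 0/0 at the
zeros of ∂_μ(p), whereas [6I]/`B5Prop11Fiber.vSym` put the continuous extension 1 there).  Unit `lit-balaban-p10` (gen 2), HOME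
as above.
-/

namespace Literature.MathematicalPhysics.QuantumFieldTheory.BalabanImbrieJaffe1984to88.BIJ85MomentumSymbols6I

open scoped BigOperators Real ComplexConjugate
open Complex Finset
open Literature.MathematicalPhysics.QuantumFieldTheory.BalabanImbrieJaffe1984to88.BIJ85MomentumSymbols71
open Literature.MathematicalPhysics.QuantumFieldTheory.Balaban1983to89

noncomputable section

variable {d : ℕ}

/-- **(7.1.4)** = [6I] (1.31), PROVED: at η = 1/n and p = p′ + l (l = 2πk, `B4Strip.shiftr n k p′`), the symbol ∂_μ(p) of
`BIJ85MomentumSymbols71` is `B5Prop11Fiber.dSym n k p′ μ`. [cite: BalabanImbrieJaffe1985, (7.1.4) p.322] -/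
theorem dSym_eq_6I {n : ℕ} (hn : n ≠ 0) (k : Fin d → Fin n) (s : Fin d → ℝ) (μ : Fin d) :
    dSym (1 / n) (B4Strip.shiftr n k s) μ = B5Prop11Fiber.dSym n k s μ := by
  unfold dSym B5Prop11Fiber.dSym
  have hn' : (n : ℂ) ≠ 0 := Nat.cast_ne_zero.mpr hn
  have e : ((1 / (n : ℝ) * B4Strip.shiftr n k s μ : ℝ) : ℂ) = ((B4Strip.shiftr n k s μ / n : ℝ) : ℂ) := by
    congr 1; ring
  rw [e, mul_comm Complex.I]
  push_cast
  field_simp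

/-- **(7.1.5)/(7.1.8)**: ∂^{(1)}(p′ + l) = ∂^{(1)}(p′) for l = 2πk — the C1 symbol `dOne` at `B4Strip.shiftr n k p′` is
`B5Prop11Fiber.d1Sym p′` ([6I] "∂_{1,μ}(p′)"). [cite: BalabanImbrieJaffe1985, (7.1.5) p.322] -/
theorem dOne_shiftr_eq_6I (n : ℕ) (k : Fin d → Fin n) (s : Fin d → ℝ) (μ : Fin d) :
    dOne (B4Strip.shiftr n k s) μ = B5Prop11Fiber.d1Sym s μ := by
  unfold dOne B5Prop11Fiber.d1Sym B4Strip.shiftr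
  have h : Complex.I * (((s μ + 2 * π * ((k μ : ℕ) : ℝ) : ℝ)) : ℂ) =
      ((s μ : ℝ) : ℂ) * Complex.I + ((k μ : ℕ) : ℤ) * (2 * π * Complex.I) := by
    push_cast
    ring
  rw [h, Complex.exp_add, Complex.exp_int_mul_two_pi_mul_I, mul_one]

/-- **(7.1.7)** = [6I] (1.61), PROVED: at η = 1/n, p = p′ + 2πk, wherever ∂_μ(p) ≠ 0, the eigenvalue v_μ(p) of
`BIJ85MomentumSymbols71` is `B5Prop11Fiber.vSym n k p′ μ` (at the zeros of ∂_μ(p) the former is 0/0 = 0, the latter 1).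
[cite: BalabanImbrieJaffe1985, (7.1.7) p.322] -/
theorem vSym_eq_6I {n : ℕ} (hn : n ≠ 0) (k : Fin d → Fin n) (s : Fin d → ℝ) (μ : Fin d)
    (hd : dSym (1 / n) (B4Strip.shiftr n k s) μ ≠ 0) :
    vSym (1 / n) (B4Strip.shiftr n k s) μ = B5Prop11Fiber.vSym n k s μ := by
  have hd' : B5Prop11Fiber.dSym n k s μ ≠ 0 := by rwa [← dSym_eq_6I hn]
  rw [vSym_eq, B5Prop11Fiber.vSym, if_neg hd', dSym_eq_6I hn, dOne_shiftr_eq_6I]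

/-- **(7.1.9)** = [6I] (1.31) *"u(p) = Π_μ ∂¹_μ(p′)/∂_μ(p)"*, PROVED: at η = 1/n, p = p′ + 2πk with no ∂_μ(p) = 0, u(p) of
`BIJ85MomentumSymbols71` is `B5Prop11Fiber.uSym n k p′`. [cite: BalabanImbrieJaffe1985, (7.1.9) p.322] -/
theorem uSym_eq_6I {n : ℕ} (hn : n ≠ 0) (k : Fin d → Fin n) (s : Fin d → ℝ)
    (hd : ∀ μ, dSym (1 / n) (B4Strip.shiftr n k s) μ ≠ 0) :
    uSym (1 / n) (B4Strip.shiftr n k s) = B5Prop11Fiber.uSym n k s := by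
  rw [uSym_eq_prod, B5Prop11Fiber.uSym]
  exact Finset.prod_congr rfl fun μ _ => vSym_eq_6I hn k s μ (hd μ)

end

end Literature.MathematicalPhysics.QuantumFieldTheory.BalabanImbrieJaffe1984to88.BIJ85MomentumSymbols6I
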